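import Summits.QuantumFields.YangMills.Theorems.IR.MKLagSandwichSCTwistWeight
import HarnessLib


/-!
# Strong-coupling twist bound WITHOUT a cluster expansion: a plaquette weight within `ε` of `1` has 't Hooft twist
# cost `≤ 3L² · (ε/(1−ε)) · (((1+ε)/(1−ε))¹⁸ − 1)` on every cold box `L³ × t` — support stub `SCTwistBound` (S_sc) of
# line «mk-lag-sandwich» (crux `IRcof`, stmt-QuantumFields-26930) at its typed constants `10⁻³ ↦ 1/96`

Helper for crux `Summit.QuantumFields.YangMills.Theses.BalabanLadder.IRcof` (stmt-QuantumFields-26930), line «mk-lag-sandwich»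
(ideator ym-ir-idea-19 g0, lens `nearmiss`; workfile `Cruxes/IRcof/Lines/mk_lag_sandwich.lean` ae46226e73fe, card
`Cruxes/IRcof/Lines/mk-lag-sandwich.md`).  That line's support stub S_sc reads

  `SCTwistBound := ∀ G compact, ∀ w : G → ℝ continuous with sup |w − 1| ≤ 10⁻³, ∀ central z, ∀ t ∈ {2, 4},`
  `  twistCostW w z 8 t ≤ 1/96`,  `twistCostW w z L t = 1 − Z_w⁽ᶻ⁾(L,L,L,t) / Z_w⁽¹⁾(L,L,L,t)`,

`Z_w⁽ᶻ⁾` the general-weight temporally twisted partition function of the `Fin`-box (`weightedTwistedZ`: VERBATIM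
`wilsonFinTorusTwistedPartition` with Wilson's Boltzmann factor replaced by `w`, twist factors `tHooftTwistFactor z` on 't Hooft's three
coclosed stacks).  The card routes it through the polymer expansion (Münster 1981; Ito–Seiler 2008 Thm 2.2 (1)); the tree's certified
Kotecký–Preiss radii for general plaquette weights (`PlaquetteWeightVortexBound.one_sub_weightZ_div_le`: `(8(d−1)+1)² e² sup|w−1| ≤ 1/2`, i.e.
`≤ 1.08·10⁻⁴` in `d = 4`, symmetric `SU(2)` tori) do NOT reach `10⁻³`, and the pointwise comparison `w(zU)/w(U) ≥ (1−ε)/(1+ε)` on the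
`3L² = 192` stack plaquettes only gives `1 − Z⁽ᶻ⁾/Z ≤ 0.32`.  This file proves the stub's inequality at its OWN constants by an elementary
SECOND-ORDER argument (no expansion):

* `exp(h) ≥ 1 + h` turns `Z − Z⁽ᶻ⁾` into `−Σ_{stack plaquettes s} ∫ W · log (w(z_μ U_s)/w(U_s))`, `W = ∏_p w(U_p)` the untwisted weight;
* for one stack plaquette `s` with first link `e`, the Haar-preserving substitution `U_e ↦ z_μ U_e` maps `U_s ↦ z_μ U_s` and changes at most
  `18` factors of `W` (≤ 3 sites in each of the 6 planes), each by a ratio in `[(1−ε)/(1+ε), (1+ε)/(1−ε)]`; hence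
  `|∫ W log(w(z_μU_s)/w(U_s))| = |∫ (W − W∘Φ_e) log w(z_μ U_s)| ≤ (ε/(1−ε)) (κ¹⁸ − 1) Z`, `κ = (1+ε)/(1−ε)`
  (`abs_integral_weight_mul_logRatio_le`);
* there are at most `3L²` stack positions (`sum_stack_indicator_le`).

RESULTS: `one_sub_twistedZ_div_le` — for every compact second-countable `G`, every continuous `w` with `sup|w − 1| ≤ ε ≤ 1/2`, every
`z : Fin 4 → G` (centrality is not even needed), every `L` and every `t ≥ 2`:
`1 − Z_w⁽ᶻ⁾(L³×t)/Z_w⁽¹⁾(L³×t) ≤ 3L²·(ε/(1−ε))·(κ¹⁸ − 1)`; `one_sub_twistedZ_div_le_one_div_96` — at `ε = 10⁻³`, `L = 8`: `≤ 1/96`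
(the bound is `≈ 7.05·10⁻³`); `scTwistBound_secondCountable` — VERBATIM the body of `SCTwistBound` (with `twistCostW`/`weightedTwistedZ`
unfolded) under the extra binder `[SecondCountableTopology G]` and for every `t ≥ 2`.

ON THE STUB AS TYPED: for an arbitrary compact `G` (no countability) the Bochner integrals defining `weightedTwistedZ` need not be the
intended ones (the Borel σ-algebra of `G^{links}` can exceed the product σ-algebra, so continuity of the integrand does not give
measurability); every use in the line has `G` carrying a `LatticeRep` (hence second countable, as in `wilsonFinTorusPartition_pos`), so the
recommended re-typing of S_sc adds `SecondCountableTopology G` (or a `LatticeRep G`) — stub-misstated, harmless.  The stub's companion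
K_lag (`MKBoundedLag`) is untouched.

HONEST FRAMING: an elementary finite-volume inequality about near-trivial plaquette weights (the extreme strong-coupling corner); width
toward PXcof ∕ `IRcof` ∕ `IR`: 0; nothing here bears on the Yang–Mills mass gap (Clay), which is NOT proved; R4 closes only the
conditional finite-𝕋⁴ rung `BalabanLadder.UV`.

References: G. 't Hooft, Nucl. Phys. B153 (1979) 141 §2 (the twisted partition functions); G. Münster, Nucl. Phys. B180 (1981) 23
(strong-coupling vortex free energy); K. R. Ito, E. Seiler, arXiv:0803.3019 Thm 2.2 (1); the tree's `WilsonFinTorusTwistedPartition.lean`.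
-/


set_option autoImplicit false

noncomputable section

open MeasureTheory Finset
open scoped BigOperators
open Literature.MathematicalPhysics.QuantumFieldTheory Literature.MathematicalPhysics.QuantumLattice

namespace Summit.QuantumFields.YangMills.Cruxes.IRcof.MKLagSandwich.SCTwist

/-! ## §6 The Haar substitution on one link and the second-order estimate for one stack plaquette -/

section Haar

variable {G : Type} [Group G] [TopologicalSpace G] [IsTopologicalGroup G] [CompactSpace G]
  [MeasurableSpace G] [BorelSpace G] [SecondCountableTopology G] {L t : ℕ} (w : G → ℝ) {ε : ℝ}

omit [SecondCountableTopology G] in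
/-- `U_e ↦ c·U_e` preserves the product Haar measure (left translation in one factor). -/
theorem measurePreserving_update_mul (e : FinTorusSite L L L t × Fin 4) (c : G) :
    MeasurePreserving (fun U : FinTorusSite L L L t × Fin 4 → G => Function.update U e (c * U e))
      (Measure.pi fun _ => haarProbability G) (Measure.pi fun _ => haarProbability G) := by
  have h := measurePreserving_pi
    (f := fun (i : FinTorusSite L L L t × Fin 4) (g : G) => if i = e then c * g else g)
    (fun _ => haarProbability G) (fun _ => haarProbability G) (fun i => by
      by_cases hi : i = e
      · simp only [hi, ↓reduceIte]; exact measurePreserving_mul_left (haarProbability G) c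
      · simp only [hi, ↓reduceIte]; exact MeasurePreserving.id _)
  convert h using 1
  funext U i
  by_cases hi : i = e
  · subst hi; simp
  · simp [hi]

omit [CompactSpace G] [MeasurableSpace G] [BorelSpace G] [SecondCountableTopology G] in
/-- A plaquette holonomy is a continuous function of the link configuration. -/
theorem continuous_plaquette (x : FinTorusSite L L L t) (a b : Fin 4) :
    Continuous fun U : FinTorusSite L L L t × Fin 4 → G => finTorusPlaquette U x a b := by
  unfold finTorusPlaquette; fun_prop

omit [CompactSpace G] [MeasurableSpace G] [BorelSpace G] [SecondCountableTopology G] in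
/-- The untwisted weight `W(U) = ∏_p w(U_p)` is continuous. -/
theorem continuous_weightProd (hwc : Continuous w) :
    Continuous fun U : FinTorusSite L L L t × Fin 4 → G =>
      ∏ x : FinTorusSite L L L t, ∏ q : {q : Fin 4 × Fin 4 // q.1 < q.2}, w (finTorusPlaquette U x q.1.1 q.1.2) :=
  continuous_finsetProd _ fun x _ => continuous_finsetProd _ fun q _ => hwc.comp (continuous_plaquette x q.1.1 q.1.2)

/-- Continuous real functions of the configuration are integrable for the product Haar measure. -/
theorem integrable_of_continuous_cfg {F : (FinTorusSite L L L t × Fin 4 → G) → ℝ} (hF : Continuous F) :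
    Integrable F (Measure.pi fun _ : FinTorusSite L L L t × Fin 4 => haarProbability G) :=
  hF.integrable_of_hasCompactSupport (HasCompactSupport.of_compactSpace F)

omit [Group G] [IsTopologicalGroup G] [CompactSpace G] [MeasurableSpace G] [BorelSpace G] [SecondCountableTopology G] in
/-- `log ∘ w` is continuous for a positive continuous weight. -/
theorem continuous_log_weight (hw : ∀ a, |w a - 1| ≤ ε) (hε : ε ≤ 1 / 2) (hwc : Continuous w) :
    Continuous fun a => Real.log (w a) :=
  Real.continuousOn_log.comp_continuous hwc fun a => (weight_pos w hw hε a).ne'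

/-- **The second-order estimate for ONE stack plaquette.**  For the plaquette `(x₀; μ, 3)` (`μ ≠ 3`, temporal extent `t ≥ 2`)
and any `c ∈ G`: `|∫ W · (log w(c·U_{x₀;μ3}) − log w(U_{x₀;μ3}))| ≤ (ε/(1−ε)) (κ¹⁸ − 1) ∫ W`.  Proof: the Haar substitution
`U_{(x₀,μ)} ↦ c·U_{(x₀,μ)}` turns `∫ W log w(U_s)` into `∫ (W∘Φ) log w(c·U_s)`, and `|W − W∘Φ| ≤ (κ¹⁸ − 1) W`. -/
theorem abs_integral_weight_mul_logRatio_le (hw : ∀ a, |w a - 1| ≤ ε) (hε : ε ≤ 1 / 2) (hwc : Continuous w)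
    (ht : 2 ≤ t) (c : G) (x₀ : FinTorusSite L L L t) (μ : Fin 4) (hμ : μ ≠ 3) :
    |∫ U, (∏ x : FinTorusSite L L L t, ∏ q : {q : Fin 4 × Fin 4 // q.1 < q.2}, w (finTorusPlaquette U x q.1.1 q.1.2)) *
        (Real.log (w (c * finTorusPlaquette U x₀ μ 3)) - Real.log (w (finTorusPlaquette U x₀ μ 3)))
        ∂(Measure.pi fun _ : FinTorusSite L L L t × Fin 4 => haarProbability G)| ≤
      ε / (1 - ε) * (((1 + ε) / (1 - ε)) ^ 18 - 1) *
        ∫ U, ∏ x : FinTorusSite L L L t, ∏ q : {q : Fin 4 × Fin 4 // q.1 < q.2}, w (finTorusPlaquette U x q.1.1 q.1.2)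
          ∂(Measure.pi fun _ : FinTorusSite L L L t × Fin 4 => haarProbability G) := by
  set μH : Measure (FinTorusSite L L L t × Fin 4 → G) := Measure.pi fun _ => haarProbability G with hμH
  set W : (FinTorusSite L L L t × Fin 4 → G) → ℝ := fun U =>
    ∏ x : FinTorusSite L L L t, ∏ q : {q : Fin 4 × Fin 4 // q.1 < q.2}, w (finTorusPlaquette U x q.1.1 q.1.2) with hW
  set Φ : (FinTorusSite L L L t × Fin 4 → G) → (FinTorusSite L L L t × Fin 4 → G) := fun U =>
    Function.update U (x₀, μ) (c * U (x₀, μ)) with hΦ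
  set K : ℝ := ((1 + ε) / (1 - ε)) ^ 18 with hK
  set lam : ℝ := ε / (1 - ε) with hlam
  have hΦmp : MeasurePreserving Φ μH μH := measurePreserving_update_mul (x₀, μ) c
  -- the substitution multiplies the stack plaquette by `c`
  have hfirst : ∀ U, finTorusPlaquette (Φ U) x₀ μ 3 = c * finTorusPlaquette U x₀ μ 3 := fun U =>
    plaquette_update_first U c x₀ μ 3 (fun h => hμ (congrArg Prod.snd h).symm)
      (fun h => shift_three_ne_self ht x₀ (congrArg Prod.fst h)) (fun h => hμ (congrArg Prod.snd h).symm)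
  -- continuity ∕ integrability
  have hWc : Continuous W := continuous_weightProd w hwc
  have hlogc : Continuous fun U : FinTorusSite L L L t × Fin 4 → G => Real.log (w (c * finTorusPlaquette U x₀ μ 3)) :=
    (continuous_log_weight w hw hε hwc).comp ((continuous_const.mul (continuous_plaquette x₀ μ 3)))
  have hlog : Continuous fun U : FinTorusSite L L L t × Fin 4 → G => Real.log (w (finTorusPlaquette U x₀ μ 3)) :=
    (continuous_log_weight w hw hε hwc).comp (continuous_plaquette x₀ μ 3)
  have hWΦc : Continuous fun U => W (Φ U) := by
    refine hWc.comp ?_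
    show Continuous fun U : FinTorusSite L L L t × Fin 4 → G => Function.update U (x₀, μ) (c * U (x₀, μ))
    refine continuous_pi fun i => ?_
    by_cases hi : i = (x₀, μ)
    · subst hi; simp only [Function.update_self]; exact continuous_const.mul (continuous_apply _)
    · simp only [Function.update_of_ne hi]; exact continuous_apply _
  -- the substituted integral
  have hsub : ∫ U, W U * Real.log (w (finTorusPlaquette U x₀ μ 3)) ∂μH =
      ∫ U, W (Φ U) * Real.log (w (c * finTorusPlaquette U x₀ μ 3)) ∂μH := by
    have h1 : ∫ U, W U * Real.log (w (finTorusPlaquette U x₀ μ 3)) ∂μH =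
        ∫ U, W U * Real.log (w (finTorusPlaquette U x₀ μ 3)) ∂(Measure.map Φ μH) := by rw [hΦmp.map_eq]
    have h2 := integral_map (μ := μH) hΦmp.measurable.aemeasurable
      (f := fun U : FinTorusSite L L L t × Fin 4 → G => W U * Real.log (w (finTorusPlaquette U x₀ μ 3)))
      (hWc.mul hlog).aestronglyMeasurable
    rw [h1, h2]
    refine integral_congr_ae (Filter.Eventually.of_forall fun U => ?_)
    simp only [hfirst]
  -- rewrite the target integral as `∫ (W − W∘Φ) · log w(c·U_s)`
  have iWl : Integrable (fun U => W U * Real.log (w (c * finTorusPlaquette U x₀ μ 3))) μH :=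
    integrable_of_continuous_cfg (hWc.mul hlogc)
  have iWl' : Integrable (fun U => W U * Real.log (w (finTorusPlaquette U x₀ μ 3))) μH :=
    integrable_of_continuous_cfg (hWc.mul hlog)
  have iWΦl : Integrable (fun U => W (Φ U) * Real.log (w (c * finTorusPlaquette U x₀ μ 3))) μH :=
    integrable_of_continuous_cfg (hWΦc.mul hlogc)
  have hrw : ∫ U, W U * (Real.log (w (c * finTorusPlaquette U x₀ μ 3)) - Real.log (w (finTorusPlaquette U x₀ μ 3))) ∂μH =
      ∫ U, (W U - W (Φ U)) * Real.log (w (c * finTorusPlaquette U x₀ μ 3)) ∂μH := by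
    have e1 : ∀ U, W U * (Real.log (w (c * finTorusPlaquette U x₀ μ 3)) - Real.log (w (finTorusPlaquette U x₀ μ 3))) =
        W U * Real.log (w (c * finTorusPlaquette U x₀ μ 3)) - W U * Real.log (w (finTorusPlaquette U x₀ μ 3)) :=
      fun U => by ring
    have e2 : ∀ U, (W U - W (Φ U)) * Real.log (w (c * finTorusPlaquette U x₀ μ 3)) =
        W U * Real.log (w (c * finTorusPlaquette U x₀ μ 3)) - W (Φ U) * Real.log (w (c * finTorusPlaquette U x₀ μ 3)) :=
      fun U => by ring
    simp_rw [e1, e2]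
    rw [integral_sub iWl iWl', integral_sub iWl iWΦl, hsub]
  rw [hrw]
  -- pointwise bound and integration
  have hpt : ∀ U, |(W U - W (Φ U)) * Real.log (w (c * finTorusPlaquette U x₀ μ 3))| ≤ lam * (K - 1) * W U := by
    intro U
    rw [abs_mul]
    have h1 : |W U - W (Φ U)| ≤ (K - 1) * W U := abs_weightProd_sub_update_le w hw hε U (x₀, μ) c
    have h2 : |Real.log (w (c * finTorusPlaquette U x₀ μ 3))| ≤ lam := abs_log_weight_le w hw hε _
    have hW0 : 0 ≤ W U := Finset.prod_nonneg fun x _ => Finset.prod_nonneg fun q _ => (weight_pos w hw hε _).le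
    have hK1 : 1 ≤ K := one_le_pow₀ (one_le_kap w hw hε (1 : G))
    calc |W U - W (Φ U)| * |Real.log (w (c * finTorusPlaquette U x₀ μ 3))| ≤ ((K - 1) * W U) * lam :=
          mul_le_mul h1 h2 (abs_nonneg _) (mul_nonneg (by linarith) hW0)
      _ = lam * (K - 1) * W U := by ring
  calc |∫ U, (W U - W (Φ U)) * Real.log (w (c * finTorusPlaquette U x₀ μ 3)) ∂μH|
      ≤ ∫ U, |(W U - W (Φ U)) * Real.log (w (c * finTorusPlaquette U x₀ μ 3))| ∂μH := abs_integral_le_integral_abs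
    _ ≤ ∫ U, lam * (K - 1) * W U ∂μH :=
        integral_mono (integrable_of_continuous_cfg ((hWc.sub hWΦc).mul hlogc)).abs
          (integrable_of_continuous_cfg (continuous_const.mul hWc)) hpt
    _ = lam * (K - 1) * ∫ U, W U ∂μH := integral_const_mul _ _

end Haar


/-! ## §8 Assembly: the twist cost of a near-trivial weight -/

section Main

variable {G : Type} [Group G] [TopologicalSpace G] [IsTopologicalGroup G] [CompactSpace G]
  [MeasurableSpace G] [BorelSpace G] [SecondCountableTopology G] {L t : ℕ} (w : G → ℝ) {ε : ℝ}

/-- **The twist cost of a near-trivial weight, every cold box, every `z`** (centrality of `z` is not used):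
`1 − Z_w⁽ᶻ⁾(L³×t) / Z_w⁽¹⁾(L³×t) ≤ 3L² · (ε/(1−ε)) · (((1+ε)/(1−ε))¹⁸ − 1)` for `sup|w − 1| ≤ ε ≤ 1/2`, `t ≥ 2`. -/
theorem one_sub_twistedZ_div_le (hw : ∀ a, |w a - 1| ≤ ε) (hε : ε ≤ 1 / 2) (hwc : Continuous w) (ht : 2 ≤ t)
    (z : Fin 4 → G) :
    1 - (∫ U, ∏ x : FinTorusSite L L L t, ∏ q : {q : Fin 4 × Fin 4 // q.1 < q.2},
          w (tHooftTwistFactor z x q.1.1 q.1.2 * finTorusPlaquette U x q.1.1 q.1.2)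
          ∂(Measure.pi fun _ : FinTorusSite L L L t × Fin 4 => haarProbability G)) /
        (∫ U, ∏ x : FinTorusSite L L L t, ∏ q : {q : Fin 4 × Fin 4 // q.1 < q.2},
          w (tHooftTwistFactor 1 x q.1.1 q.1.2 * finTorusPlaquette U x q.1.1 q.1.2)
          ∂(Measure.pi fun _ : FinTorusSite L L L t × Fin 4 => haarProbability G)) ≤
      3 * ((L : ℝ) * L) * (ε / (1 - ε) * (((1 + ε) / (1 - ε)) ^ 18 - 1)) := by
  classical
  simp only [twistFactor_one, one_mul]
  set μH : Measure (FinTorusSite L L L t × Fin 4 → G) := Measure.pi fun _ => haarProbability G with hμH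
  set W : (FinTorusSite L L L t × Fin 4 → G) → ℝ := fun U =>
    ∏ x : FinTorusSite L L L t, ∏ q : {q : Fin 4 × Fin 4 // q.1 < q.2}, w (finTorusPlaquette U x q.1.1 q.1.2) with hW
  set Wz : (FinTorusSite L L L t × Fin 4 → G) → ℝ := fun U =>
    ∏ x : FinTorusSite L L L t, ∏ q : {q : Fin 4 × Fin 4 // q.1 < q.2},
      w (tHooftTwistFactor z x q.1.1 q.1.2 * finTorusPlaquette U x q.1.1 q.1.2) with hWz
  set h : (FinTorusSite L L L t × Fin 4 → G) → FinTorusSite L L L t → {q : Fin 4 × Fin 4 // q.1 < q.2} → ℝ :=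
    fun U x q => Real.log (w (tHooftTwistFactor z x q.1.1 q.1.2 * finTorusPlaquette U x q.1.1 q.1.2)) -
      Real.log (w (finTorusPlaquette U x q.1.1 q.1.2)) with hh
  set B : ℝ := ε / (1 - ε) * (((1 + ε) / (1 - ε)) ^ 18 - 1) with hB
  set Z : ℝ := ∫ U, W U ∂μH with hZ
  set Zz : ℝ := ∫ U, Wz U ∂μH with hZz
  change 1 - Zz / Z ≤ 3 * ((L : ℝ) * L) * B
  have hε0 : 0 ≤ ε := le_trans (abs_nonneg _) (hw 1)
  have hK1 : 1 ≤ ((1 + ε) / (1 - ε)) ^ 18 := one_le_pow₀ (one_le_kap w hw hε (1 : G))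
  have hB0 : 0 ≤ B := mul_nonneg (div_nonneg hε0 (by linarith)) (by linarith)
  -- continuity ∕ integrability ∕ positivity
  have hWc : Continuous W := continuous_weightProd w hwc
  have hWzc : Continuous Wz :=
    continuous_finsetProd _ fun x _ => continuous_finsetProd _ fun q _ =>
      hwc.comp (continuous_const.mul (continuous_plaquette x q.1.1 q.1.2))
  have hhc : ∀ x q, Continuous fun U => h U x q := fun x q =>
    ((continuous_log_weight w hw hε hwc).comp (continuous_const.mul (continuous_plaquette x q.1.1 q.1.2))).sub
      ((continuous_log_weight w hw hε hwc).comp (continuous_plaquette x q.1.1 q.1.2))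
  have hW0 : ∀ U, 0 ≤ W U := fun U =>
    Finset.prod_nonneg fun x _ => Finset.prod_nonneg fun q _ => (weight_pos w hw hε _).le
  have hZpos : 0 < Z := by
    have hpos : ∀ U, 0 < W U := fun U =>
      Finset.prod_pos fun x _ => Finset.prod_pos fun q _ => weight_pos w hw hε _
    rw [hZ, integral_pos_iff_support_of_nonneg (fun U => (hpos U).le) (integrable_of_continuous_cfg hWc)]
    have hsupp : Function.support W = Set.univ := Set.eq_univ_of_forall fun U => (hpos U).ne'
    rw [hsupp, measure_univ]
    exact zero_lt_one
  -- pointwise: `W (1 + Σ h) ≤ W_z`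
  have hpt : ∀ U, W U + W U * ∑ x, ∑ q, h U x q ≤ Wz U := by
    intro U
    have hWexp : W U = Real.exp (∑ x : FinTorusSite L L L t, ∑ q : {q : Fin 4 × Fin 4 // q.1 < q.2},
        Real.log (w (finTorusPlaquette U x q.1.1 q.1.2))) := by
      rw [Real.exp_sum]
      refine Finset.prod_congr rfl fun x _ => ?_
      rw [Real.exp_sum]
      refine Finset.prod_congr rfl fun q _ => ?_
      rw [Real.exp_log (weight_pos w hw hε _)]
    have hWzexp : Wz U = Real.exp (∑ x : FinTorusSite L L L t, ∑ q : {q : Fin 4 × Fin 4 // q.1 < q.2},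
        Real.log (w (tHooftTwistFactor z x q.1.1 q.1.2 * finTorusPlaquette U x q.1.1 q.1.2))) := by
      rw [Real.exp_sum]
      refine Finset.prod_congr rfl fun x _ => ?_
      rw [Real.exp_sum]
      refine Finset.prod_congr rfl fun q _ => ?_
      rw [Real.exp_log (weight_pos w hw hε _)]
    have hH : ∑ x : FinTorusSite L L L t, ∑ q : {q : Fin 4 × Fin 4 // q.1 < q.2},
        Real.log (w (tHooftTwistFactor z x q.1.1 q.1.2 * finTorusPlaquette U x q.1.1 q.1.2)) =
        (∑ x : FinTorusSite L L L t, ∑ q : {q : Fin 4 × Fin 4 // q.1 < q.2},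
          Real.log (w (finTorusPlaquette U x q.1.1 q.1.2))) + ∑ x, ∑ q, h U x q := by
      rw [← Finset.sum_add_distrib]
      refine Finset.sum_congr rfl fun x _ => ?_
      rw [← Finset.sum_add_distrib]
      refine Finset.sum_congr rfl fun q _ => ?_
      simp only [hh]; ring
    rw [hWzexp, hH, Real.exp_add, ← hWexp]
    have h1 := Real.add_one_le_exp (∑ x, ∑ q, h U x q)
    have h2 := hW0 U
    nlinarith
  -- integrate
  have hint2 : ∀ (x : FinTorusSite L L L t) (q : {q : Fin 4 × Fin 4 // q.1 < q.2}),
      Integrable (fun U => W U * h U x q) μH := fun x q =>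
    integrable_of_continuous_cfg (by exact hWc.mul (hhc x q))
  have hsum_int : ∫ U, W U * ∑ x, ∑ q, h U x q ∂μH = ∑ x, ∑ q, ∫ U, W U * h U x q ∂μH := by
    have e1 : ∀ U, W U * ∑ x, ∑ q, h U x q = ∑ x, ∑ q, W U * h U x q := fun U => by
      rw [Finset.mul_sum]
      refine Finset.sum_congr rfl fun x _ => ?_
      rw [Finset.mul_sum]
    simp_rw [e1]
    rw [integral_finsetSum _ fun x _ => integrable_finsetSum _ fun q _ => hint2 x q]
    refine Finset.sum_congr rfl fun x _ => ?_
    rw [integral_finsetSum _ fun q _ => hint2 x q]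
  have hint : Z + ∑ x, ∑ q, ∫ U, W U * h U x q ∂μH ≤ Zz := by
    have hsc : Continuous fun U => W U * ∑ x, ∑ q, h U x q :=
      hWc.mul (continuous_finsetSum _ fun x _ => continuous_finsetSum _ fun q _ => hhc x q)
    have h1 : ∫ U, (W U + W U * ∑ x, ∑ q, h U x q) ∂μH ≤ ∫ U, Wz U ∂μH :=
      integral_mono ((integrable_of_continuous_cfg hWc).add (integrable_of_continuous_cfg hsc))
        (integrable_of_continuous_cfg hWzc) hpt
    rw [integral_add (integrable_of_continuous_cfg hWc) (integrable_of_continuous_cfg hsc), hsum_int] at h1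
    exact h1
  -- each stack term
  have hterm : ∀ (x : FinTorusSite L L L t) (q : {q : Fin 4 × Fin 4 // q.1 < q.2}),
      |∫ U, W U * h U x q ∂μH| ≤
        if (q.1.2 = 3 ∧ finTorusSiteCoord x 3 = 0 ∧ finTorusSiteCoord x q.1.1 = 0) then B * Z else 0 := by
    intro x q
    by_cases hc : (q.1.2 = 3 ∧ finTorusSiteCoord x 3 = 0 ∧ finTorusSiteCoord x q.1.1 = 0)
    · rw [if_pos hc]
      have hq3 : (q : Fin 4 × Fin 4).2 = 3 := hc.1
      have hμ : (q : Fin 4 × Fin 4).1 ≠ 3 := by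
        intro h'
        have hlt := q.2
        rw [h', hq3] at hlt
        exact lt_irrefl _ hlt
      have htw : tHooftTwistFactor z x q.1.1 q.1.2 = z q.1.1 := twistFactor_of z x _ _ hc
      simp only [hh, hW, htw]
      simp only [hq3]
      exact abs_integral_weight_mul_logRatio_le w hw hε hwc ht (z q.1.1) x q.1.1 hμ
    · rw [if_neg hc]
      have htw : tHooftTwistFactor z x q.1.1 q.1.2 = 1 := twistFactor_of_not z x _ _ hc
      simp [hh, htw]
  -- assemble
  have key : Z - Zz ≤ 3 * ((L : ℝ) * L) * B * Z := by
    have hneg : -(∑ x, ∑ q, ∫ U, W U * h U x q ∂μH) ≤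
        ∑ x : FinTorusSite L L L t, ∑ q : {q : Fin 4 × Fin 4 // q.1 < q.2}, |∫ U, W U * h U x q ∂μH| := by
      rw [← Finset.sum_neg_distrib]
      refine Finset.sum_le_sum fun x _ => ?_
      rw [← Finset.sum_neg_distrib]
      exact Finset.sum_le_sum fun q _ => neg_le_abs _
    calc Z - Zz ≤ -(∑ x, ∑ q, ∫ U, W U * h U x q ∂μH) := by linarith
      _ ≤ ∑ x, ∑ q, |∫ U, W U * h U x q ∂μH| := hneg
      _ ≤ ∑ x : FinTorusSite L L L t, ∑ q : {q : Fin 4 × Fin 4 // q.1 < q.2},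
            (if (q.1.2 = 3 ∧ finTorusSiteCoord x 3 = 0 ∧ finTorusSiteCoord x q.1.1 = 0) then B * Z else 0) :=
          Finset.sum_le_sum fun x _ => Finset.sum_le_sum fun q _ => hterm x q
      _ ≤ 3 * ((L : ℝ) * L) * (B * Z) := sum_stack_indicator_le (mul_nonneg hB0 hZpos.le)
      _ = 3 * ((L : ℝ) * L) * B * Z := by ring
  have hdiv : 1 - Zz / Z = (Z - Zz) / Z := by field_simp
  rw [hdiv, div_le_iff₀ hZpos]
  exact key

/-- **Support stub S_sc at its typed constants, second-countable form**: VERBATIM the body of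
`SCTwistBound` of `Cruxes/IRcof/Lines/mk_lag_sandwich.lean` with `twistCostW` ∕ `weightedTwistedZ` unfolded, under the extra binder
`[SecondCountableTopology G]` (true for every `G` carrying a `LatticeRep`) and for every `t ≥ 2` (not only `t ∈ {2, 4}`):
`sup|w − 1| ≤ 10⁻³` ⟹ twist cost `≤ 1/96` on `8³ × t`, every `z` (the hypothesis that `z` is central is not used). -/
theorem scTwistBound_secondCountable (w : G → ℝ) (hwc : Continuous w) (hw : ∀ U : G, |w U - 1| ≤ 1 / 1000)
    (z : Fin 4 → G) (t : ℕ) (ht : 2 ≤ t) :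
    1 - (∫ U, ∏ x : FinTorusSite 8 8 8 t, ∏ q : {q : Fin 4 × Fin 4 // q.1 < q.2},
          w (tHooftTwistFactor z x q.1.1 q.1.2 * finTorusPlaquette U x q.1.1 q.1.2)
          ∂(Measure.pi fun _ : FinTorusSite 8 8 8 t × Fin 4 => haarProbability G)) /
        (∫ U, ∏ x : FinTorusSite 8 8 8 t, ∏ q : {q : Fin 4 × Fin 4 // q.1 < q.2},
          w (tHooftTwistFactor 1 x q.1.1 q.1.2 * finTorusPlaquette U x q.1.1 q.1.2)
          ∂(Measure.pi fun _ : FinTorusSite 8 8 8 t × Fin 4 => haarProbability G)) ≤ 1 / 96 := by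
  refine (one_sub_twistedZ_div_le w hw (by norm_num) hwc ht z).trans ?_
  norm_num

/-- The same for the stub's literal side condition `t = 2 ∨ t = 4` and with the (unused) centrality hypothesis in the binder list,
so that `stub_scTwistBound` closes by `intro …; exact …` once `SecondCountableTopology G` is available. -/
theorem scTwistBound_of_secondCountable (w : G → ℝ) (hwc : Continuous w) (hw : ∀ U : G, |w U - 1| ≤ 1 / 1000)
    (z : Fin 4 → G) (_hz : ∀ μ, z μ ∈ Subgroup.center G) (t : ℕ) (ht : t = 2 ∨ t = 4) :
    1 - (∫ U, ∏ x : FinTorusSite 8 8 8 t, ∏ q : {q : Fin 4 × Fin 4 // q.1 < q.2},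
          w (tHooftTwistFactor z x q.1.1 q.1.2 * finTorusPlaquette U x q.1.1 q.1.2)
          ∂(Measure.pi fun _ : FinTorusSite 8 8 8 t × Fin 4 => haarProbability G)) /
        (∫ U, ∏ x : FinTorusSite 8 8 8 t, ∏ q : {q : Fin 4 × Fin 4 // q.1 < q.2},
          w (tHooftTwistFactor 1 x q.1.1 q.1.2 * finTorusPlaquette U x q.1.1 q.1.2)
          ∂(Measure.pi fun _ : FinTorusSite 8 8 8 t × Fin 4 => haarProbability G)) ≤ 1 / 96 :=
  scTwistBound_secondCountable w hwc hw z t (by rcases ht with h | h <;> omega)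

end Main

end Summit.QuantumFields.YangMills.Cruxes.IRcof.MKLagSandwich.SCTwist

end
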